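import Summits.Ventures.HodgeRepro2.T5SU11KernelResolventIdentityEdge
import Summits.Ventures.HodgeRepro2.T5SU11KernelDifferenceRegularity
import Summits.Ventures.HodgeRepro2.T5SU11ResolventTransformEdge

/-!
# Summary XIII — the Green's kernel of the radial Laplacian (rows 509–511, 514–516, 518–521), under uniform names

The headline statements about the kernel `K_λ(t, s) = −φ_λ(min(t,s)) χ_λ(max(t,s))` of the resolvent of the explicit
model, re-exported:

* `greenI_eq_integral_kernel` — `G^I_λ g(t) = ∫_{(0,∞)} K_λ(t, s) g(s) sinh 2s ds` (row 509);
* `kernel_resolvent_identity` — **`(μ − μ₂) ∫ K_λ(t,r) K_{λ₂}(r,s) sinh 2r dr = K_λ(t,s) − K_{λ₂}(t,s)`** (row 511), and at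
  the spectral edge `kernel_resolvent_identity_edge` — **`(μ + 1) ∫ K_λ(t,r) K_1(r,s) sinh 2r dr = K_λ(t,s) − K_1(t,s)`**
  (row 516);
* `kernel_mono`, `kernel_one_le` — `K_{λ₂} ≤ K_λ ≤ 0` for `1 < λ₂ ≤ λ` and `K_1 ≤ K_λ` (rows 511, 516);
* `greenI_kernel`, `kernel_diff_ode` — the kernel is a source of the class, `G^I_λ(K_{λ₂}(·, s)) =
  (K_λ − K_{λ₂})(·, s)/(μ − μ₂)`, and the difference quotient solves `(L − μ) u = K_{λ₂}(·, s)` across the diagonal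
  (row 518);
* `greenI_sph`, `greenI_sph_one` — **the spherical functions are eigenfunctions of the resolvent**:
  `G^I_λ φ_{λ′} = φ_{λ′}/(μ′ − μ)` for `1 < λ′ < λ`, and `G^I_λ Ξ = −Ξ/(μ + 1)` (row 519);
* `transform_greenI`, `transform_greenI_one` — **the spherical transform diagonalises the resolvent on the class**:
  `(G^I_λ g)^(λ′) = ĝ(λ′)/(μ′ − μ)` and `(G^I_λ g)^(1) = −ĝ(1)/(μ + 1)` (rows 520–521).

Nothing is claimed about (N).

Blind lane: Mathlib + the HodgeRepro2 prefix only; no sorry; axioms ⊆ {propext, Classical.choice,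
Quot.sound}.
-/

namespace Summit.Ventures.HodgeRepro2.T5SU11RadialSummaryXIII

open Filter Topology MeasureTheory
open Set (Ioi Ioc)
open T5SU11Cartan T5SU11SphericalFunction T5SU11SphericalDecay T5SU11RadialGreenKernel T5SU11RadialGreenImproper
  T5SU11ResolventKernelComposition T5SU11KernelResolventIdentity T5SU11KernelResolventIdentityEdge
  T5SU11KernelDifferenceRegularity T5SU11ResolventEigenfunction T5SU11ResolventTransformClass
  T5SU11ResolventTransformEdge

section measure

variable [MeasurableSpace Circle] [BorelSpace Circle]

omit [BorelSpace Circle] in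
/-- **The improper Green's operator as an integral operator** (row 509). -/
theorem greenI_eq_integral_kernel {lam : ℝ} {g : ℝ → ℝ}
    (hB : ∀ T, IntegrableOn (fun s => sph lam (hyp s) * g s * Real.sinh (2 * s)) (Ioc 0 T))
    (hA : IntegrableOn (fun s => sphDecay lam s * g s * Real.sinh (2 * s)) (Ioi 0)) {t : ℝ} (ht : 0 < t) :
    greenSolI (fun t => sph lam (hyp t)) (sphDecay lam) g t
      = ∫ s in Ioi 0, sphGreenKernel lam t s * g s * Real.sinh (2 * s) :=
  greenSolI_eq_integral_kernel hB hA ht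

/-- **The kernel resolvent identity** (row 511). -/
theorem kernel_resolvent_identity {lam lam₂ : ℝ} (hlam : 1 < lam) (hlam₂ : 1 < lam₂) {t s : ℝ} (ht : 0 < t)
    (hs : 0 < s) :
    (lam * (lam - 2) - lam₂ * (lam₂ - 2))
        * ∫ r in Ioi 0, sphGreenKernel lam t r * sphGreenKernel lam₂ r s * Real.sinh (2 * r)
      = sphGreenKernel lam t s - sphGreenKernel lam₂ t s :=
  T5SU11KernelResolventIdentity.kernel_resolvent_identity hlam hlam₂ ht hs

/-- **The kernel resolvent identity at the spectral edge** (row 516). -/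
theorem kernel_resolvent_identity_edge {lam : ℝ} (hlam : 1 < lam) {t s : ℝ} (ht : 0 < t) (hs : 0 < s) :
    (lam * (lam - 2) - 1 * (1 - 2))
        * ∫ r in Ioi 0, sphGreenKernel lam t r * sphGreenKernel 1 r s * Real.sinh (2 * r)
      = sphGreenKernel lam t s - sphGreenKernel 1 t s :=
  T5SU11KernelResolventIdentityEdge.kernel_resolvent_identity_edge hlam ht hs

/-- **The kernel is monotone in the spectral parameter** (row 511). -/
theorem kernel_mono {lam lam₂ : ℝ} (hlam : 1 < lam) (hlam₂ : 1 < lam₂) (hle : lam₂ ≤ lam) {t s : ℝ} (ht : 0 < t)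
    (hs : 0 < s) : sphGreenKernel lam₂ t s ≤ sphGreenKernel lam t s :=
  sphGreenKernel_mono hlam hlam₂ hle ht hs

/-- **The edge kernel is the smallest Green's kernel** (row 516). -/
theorem kernel_one_le {lam : ℝ} (hlam : 1 < lam) {t s : ℝ} (ht : 0 < t) (hs : 0 < s) :
    sphGreenKernel 1 t s ≤ sphGreenKernel lam t s :=
  sphGreenKernel_one_le hlam ht hs

/-- **The resolvent applied to the kernel** (row 518). -/
theorem greenI_kernel {lam lam₂ : ℝ} (hlam : 1 < lam) (hlam₂ : 1 < lam₂) {s : ℝ} (hs : 0 < s) (hne : lam ≠ lam₂)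
    {t : ℝ} (ht : 0 < t) :
    greenSolI (fun t => sph lam (hyp t)) (sphDecay lam) (fun r => sphGreenKernel lam₂ r s) t
      = (sphGreenKernel lam t s - sphGreenKernel lam₂ t s) / (lam * (lam - 2) - lam₂ * (lam₂ - 2)) :=
  greenSolI_kernel_eq hlam hlam₂ hs hne ht

/-- **The difference quotient of two kernels solves `(L − μ) u = K_{λ₂}(·, s)` across the diagonal** (row 518). -/
theorem kernel_diff_ode {lam lam₂ : ℝ} (hlam : 1 < lam) (hlam₂ : 1 < lam₂) {s : ℝ} (hs : 0 < s) (hne : lam ≠ lam₂)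
    {t : ℝ} (ht : 0 < t) :
    Real.sinh (2 * t) * greenSolI'' (deriv (deriv fun t => sph lam (hyp t))) (sphDecay'' lam)
        (deriv fun t => sph lam (hyp t)) (sphDecay' lam) (fun t => sph lam (hyp t)) (sphDecay lam)
        (fun r => sphGreenKernel lam₂ r s) t
      + 2 * Real.cosh (2 * t) * greenSolI' (deriv fun t => sph lam (hyp t)) (sphDecay' lam)
        (fun t => sph lam (hyp t)) (sphDecay lam) (fun r => sphGreenKernel lam₂ r s) t
      = lam * (lam - 2) * Real.sinh (2 * t)
          * ((sphGreenKernel lam t s - sphGreenKernel lam₂ t s) / (lam * (lam - 2) - lam₂ * (lam₂ - 2)))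
        + Real.sinh (2 * t) * sphGreenKernel lam₂ t s :=
  T5SU11KernelDifferenceRegularity.kernel_diff_ode hlam hlam₂ hs hne ht

/-- **The spherical functions are eigenfunctions of the resolvent** (row 519). -/
theorem greenI_sph {lam lam' : ℝ} (hlam : 1 < lam) (h1 : 1 < lam') (h2 : lam' < lam) {t : ℝ} (ht : 0 < t) :
    greenSolI (fun t => sph lam (hyp t)) (sphDecay lam) (fun s => sph lam' (hyp s)) t
      = sph lam' (hyp t) / (lam' * (lam' - 2) - lam * (lam - 2)) :=
  greenSolI_sph_eq hlam h1 h2 ht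

/-- **The resolvent of the ground state** (row 519). -/
theorem greenI_sph_one {lam : ℝ} (hlam : 1 < lam) {t : ℝ} (ht : 0 < t) :
    greenSolI (fun t => sph lam (hyp t)) (sphDecay lam) (fun s => sph 1 (hyp s)) t
      = -(sph 1 (hyp t) / (lam * (lam - 2) + 1)) :=
  greenSolI_sph_one_eq hlam ht

/-- **The spherical transform diagonalises the resolvent on the class** (row 520). -/
theorem transform_greenI {lam lam' : ℝ} (hlam : 1 < lam) (h1 : 1 < lam') (h2 : lam' < lam)
    {g : ℝ → ℝ} (hg : ContinuousOn g (Ioi 0)) {M : ℝ} (hM : ∀ s ∈ Ioc (0 : ℝ) 1, |g s| ≤ M) (hM0 : 0 ≤ M)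
    {ε C s₀ : ℝ} (hε : lam' < ε) (hC : ∀ s, s₀ ≤ s → |g s| ≤ C * Real.exp (-ε * s)) :
    ∫ t in Ioi 0, greenSolI (fun t => sph lam (hyp t)) (sphDecay lam) g t * sph lam' (hyp t) * Real.sinh (2 * t)
      = (∫ s in Ioi 0, g s * sph lam' (hyp s) * Real.sinh (2 * s)) / (lam' * (lam' - 2) - lam * (lam - 2)) :=
  transform_greenSolI_eq hlam h1 h2 hg hM hM0 hε hC

/-- **The ground-state coefficient of the resolvent on the class** (row 521). -/
theorem transform_greenI_one {lam : ℝ} (hlam : 1 < lam) {g : ℝ → ℝ} (hg : ContinuousOn g (Ioi 0))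
    {M : ℝ} (hM : ∀ s ∈ Ioc (0 : ℝ) 1, |g s| ≤ M) (hM0 : 0 ≤ M)
    {ε C s₀ : ℝ} (hC : ∀ s, s₀ ≤ s → |g s| ≤ C * Real.exp (-ε * s)) (hε1 : 1 < ε) :
    ∫ t in Ioi 0, greenSolI (fun t => sph lam (hyp t)) (sphDecay lam) g t * sph 1 (hyp t) * Real.sinh (2 * t)
      = -(∫ s in Ioi 0, g s * sph 1 (hyp s) * Real.sinh (2 * s)) / (lam * (lam - 2) + 1) :=
  transform_greenSolI_one_eq hlam hg hM hM0 hC hε1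

end measure

end Summit.Ventures.HodgeRepro2.T5SU11RadialSummaryXIII
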